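import Summits.BirchSwinnertonDyer.BirchSwinnertonDyer.Theorems.Rank2ObservatoryTamagawaIntModel
import HarnessLib

/-!
# BSD rank ≥ 2 observatory (`b2b-bsdr2`, cert-2 gen 10): KERNEL CERTIFICATES of the local Tamagawa
# number `c_p` of an integer equation at a bad prime — part 2/3: the local certificate `TamLocal`

HONEST FRAMING: per-curve certified theorems and census instruments; no claim on BSD in rank ≥ 2.

Theorems and a kernel-decidable certificate format only (no named fact, no axiom).  For an integer
equation `W₀ : WeierstrassCurve ℤ` and a finite place `v` of `𝓞 ℚ` over a prime `p`, with
`c_v = tam W₀ v = ((W₀ ⊗ ℚ) ⊗ ℚ_v).localTamagawaNumber O_v` (part 1,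
`Rank2ObservatoryTamagawaIntModel`), a `TamLocal` certificate names `p` (primality by trial
division), `n = v_p(Δ(W₀))` and ONE of five kernel-checkable local situations; the kernel check
`TamLocal.check` implies (`TamLocal.sound`, given minimality of `W₀` at `v`):

* kind `1` — SPLIT multiplicative (`p ∤ c₄`, a root `w` of the node-tangent quadratic modulo `p`):
  `c_v = n` EXACTLY (the tree's
  `localTamagawaNumber_eq_ordMinimalDiscriminant_of_hasSplitMultiplicativeReductionAt`,
  Silverman *ATAEC* IV.9.4 Step 2);
* kind `2` / `3` — NON-SPLIT multiplicative (`p ∤ c₄`; no root modulo `p` by exhaustion of `t < p`,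
  resp. by an Euler witness `d^{(p−1)/2} ≡ −1` on the discriminant `d` of the quadratic, `p` odd):
  `c_v = 2` if `n` is even, `1` if odd, EXACTLY (the tree's
  `localTamagawaNumber_of_hasNonsplitMultiplicativeReductionAt_holds`);
* kind `4` — a Step-2 Tate certificate (`Tate.Step2Cert`, cert-2 gen 6: types `II`, `III`, `IV`);
* kind `5` — a deep Tate certificate (`Tate.DeepCert`, cert-2 gen 7: `I₀*`, `Iₙ*`, `IV*`, `III*`, `II*`);
  for kinds `4`, `5` the Kodaira symbol is certified in the kernel and `c_v` lies in the tree's PROVED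
  value set `kodairaVals` of that symbol: `II, II* ↦ {1}`, `III, III* ↦ {2}` (exact),
  `IV, IV* ↦ {1,3}`, `I₀* ↦ {1,2,4}`, `Iₙ* ↦ {2,4}` (the disjunctions the tree proves; exactness for
  these four types needs the residual quadratic / cubic of Tate's algorithm, not yet in the tree).

The certificate also records the engines' value `c` (engine 1 = the cell's `tate_deep.py` extended
with Tate's `c`-rules, engine 2 = PARI `elllocalred`) and the kernel checks `c ∈ vals`; so a passing
certificate proves `c_v ∈ vals ∋ c` — `c_v = c` when `vals` is a singleton ("kernel-exact"), a
kernel bracket otherwise.  Part 3 (`Rank2ObservatoryTamagawaCert`) assembles rows and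
`tamagawaProduct`.

References: J. H. Silverman, *Advanced Topics in the Arithmetic of Elliptic Curves*, GTM 151 (1994),
IV.9.4 (Tate's algorithm and the values `c`), Cor. IV.9.2 [SilvermanATAEC1994] [Silverman1994];
J. H. Silverman, *The Arithmetic of Elliptic Curves*, 2nd ed. (2009), VII.5 Prop. 5.1
[SilvermanAEC2009]; J. E. Cremona, *Algorithms for Modular Elliptic Curves*, 2nd ed. (1997), §3.2 and
Table 1 [CremonaAlgorithms1997].
-/

set_option linter.dupNamespace false
set_option autoImplicit false

open scoped NumberField
open Polynomial IsLocalRing IsDedekindDomain Rat.HeightOneSpectrum WeierstrassCurve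
  Literature.NumberTheory.EllipticCurves Literature.NumberTheory.GaloisRepresentations
  Literature.NumberTheory.DiophantineGeometry Literature.NumberTheory.DiophantineGeometry.TateAlgorithm
  Literature.NumberTheory.Sieve

namespace Summit.BirchSwinnertonDyer.BirchSwinnertonDyer.Rank2Observatory.Tam

open Tate
open Tate.Step2Cert (pdvd pexact pdvd_iff pexact_iff)

/-! ### The local certificate -/

/-- A LOCAL TAMAGAWA CERTIFICATE of an integer equation at a bad prime `p`: `sq = ⌊√p⌋` (primality by
trial division), `n = v_p(Δ)`, the `kind` — `1` split multiplicative (root witness `w`), `2` non-split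
by exhaustion of `t < p`, `3` non-split by an Euler witness (`p` odd), `4` a Step-2 Tate certificate
`⟨p, r, s, t, n, exit, k⟩`, `5` a deep Tate certificate `⟨p, r, s, t, n, exit, k⟩` (`k` = the round
`m`) — and the engines' value `c`. [cite: SilvermanATAEC1994, IV.9.4] -/
structure TamLocal where
  /-- the prime -/
  p : ℕ
  /-- `⌊√p⌋` -/
  sq : ℕ
  /-- `1` split, `2` non-split (exhaustion), `3` non-split (Euler), `4` Step-2 cert, `5` deep cert -/
  kind : ℕ
  /-- root of the node-tangent quadratic mod `p` (kind `1`) -/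
  w : ℤ
  /-- translation `x = x' + r` (kinds `4`, `5`) -/
  r : ℤ
  /-- `y = y' + s x' + t` -/
  s : ℤ
  /-- `y = y' + s x' + t` -/
  t : ℤ
  /-- `n = v_p(Δ)` -/
  n : ℕ
  /-- the exit of Tate's algorithm (kinds `4`, `5`) -/
  exit : ℕ
  /-- the exact valuation tested at the exit (kind `4`) / the round `m` (kind `5`) -/
  k : ℕ
  /-- the Tamagawa number `c_p` computed by the engines (checked to lie in `vals`) -/
  c : ℕ
  deriving Repr, DecidableEq, Inhabited

namespace TamLocal

variable (E : TamLocal) (W : WeierstrassCurve ℤ)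

/-- The Step-2 Tate certificate carried by a kind-`4` certificate. [folklore] -/
def toStep2 : Step2Cert := ⟨E.p, E.r, E.s, E.t, E.n, E.exit, E.k⟩

/-- The deep Tate certificate carried by a kind-`5` certificate. [folklore] -/
def toDeep : DeepCert := ⟨E.p, E.r, E.s, E.t, E.n, E.exit, E.k⟩

/-- The certified VALUE SET of `c_p`: `{n}` split, `{2}` / `{1}` non-split by parity of `n`, the proved
set of the certified Kodaira type otherwise. [cite: SilvermanATAEC1994, IV.9.4] -/
def vals : List ℕ :=
  if E.kind = 1 then [E.n]
  else if E.kind = 2 ∨ E.kind = 3 then [if E.n % 2 = 0 then 2 else 1]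
  else if E.kind = 4 then kodairaVals E.toStep2.type
  else kodairaVals E.toDeep.type

/-- Primality as a Boolean: `p = 2` or the trial-division certificate with `⌊√p⌋ = sq`. [folklore] -/
def primeB (p sq : ℕ) : Bool := decide (p = 2) || GoldbachLinnik.primeCert p (sq + 1)

/-- The kernel check of a local Tamagawa certificate on the integer equation `W`: `p` prime,
`pⁿ ∥ Δ(W)` with `n ≥ 1`, the engines' value in the certified set, and the kind's own test.
[cite: SilvermanATAEC1994, IV.9.4] -/
def check : Bool :=
  primeB E.p E.sq && decide (1 ≤ E.n) && pexact E.p E.n W.Δ && decide (E.c ∈ E.vals) &&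
  ((E.kind == 1 && decide (¬ (E.p : ℤ) ∣ W.c₄) && decide ((E.p : ℤ) ∣ RootNumber.nodalValue W E.w)) ||
    (E.kind == 2 && decide (¬ (E.p : ℤ) ∣ W.c₄) &&
      (List.range E.p).all (fun t => !decide ((E.p : ℤ) ∣ RootNumber.nodalValue W t))) ||
    (E.kind == 3 && decide (¬ (E.p : ℤ) ∣ W.c₄) && decide (E.p ≠ 2) &&
      (RootNumber.binPowMod ((RootNumber.nodalDisc W % (E.p : ℤ)).toNat) (E.p / 2) E.p == E.p - 1)) ||
    (E.kind == 4 && E.toStep2.check W) ||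
    (E.kind == 5 && E.toDeep.check W))

variable {E W}

/-- Soundness of `primeB`. [folklore] -/
theorem prime_of_primeB {p sq : ℕ} (h : primeB p sq = true) : p.Prime := by
  simp only [primeB, Bool.or_eq_true, decide_eq_true_eq] at h
  rcases h with rfl | h
  · exact Nat.prime_two
  · exact GoldbachLinnik.prime_of_primeCert h

/-- Unpacking a passing check: the common part. [folklore] -/
theorem check_common (hc : E.check W = true) :
    E.p.Prime ∧ 1 ≤ E.n ∧ ((E.p : ℤ) ^ E.n ∣ W.Δ ∧ ¬ (E.p : ℤ) ^ (E.n + 1) ∣ W.Δ) ∧ E.c ∈ E.vals := by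
  simp only [check, Bool.and_eq_true, decide_eq_true_eq, pexact_iff] at hc
  exact ⟨prime_of_primeB hc.1.1.1.1, hc.1.1.1.2, hc.1.1.2, hc.1.2⟩

/-- The check implies `Δ(W) ≠ 0`, so `W ⊗ ℚ` is an elliptic curve. [folklore] -/
theorem isElliptic_of_check (hc : E.check W = true) : (W.baseChange ℚ).IsElliptic := by
  obtain ⟨-, -, ⟨-, hΔ'⟩, -⟩ := check_common hc
  refine ⟨(show (W.baseChange ℚ).Δ ≠ 0 from ?_).isUnit⟩
  rw [baseChange_int_Δ, Int.cast_ne_zero]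
  rintro h0; rw [h0] at hΔ'; exact hΔ' (dvd_zero _)

/-- **Soundness of a local Tamagawa certificate.**  If `E.check W₀` holds and `W₀ ⊗ ℚ` is minimal at
the place `v` of `𝓞 ℚ` over `E.p`, then `c_v ∈ E.vals`: split multiplicative `c_v = v_p(Δ)`
(*ATAEC* IV.9.4 Step 2, Cor. IV.9.2(d)); non-split `c_v = 2` or `1` by the parity of `v_p(Δ)` (Step 2);
additive: the Kodaira type is certified (`Step2Cert.sound`, `DeepCert.sound`) and `c_v` lies in the
tree's proved value set of that type (Steps 3–10).  NO named fact.
[cite: SilvermanATAEC1994, IV.9.4] [cite: SilvermanAEC2009, VII.5 Prop. 5.1(b)] -/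
theorem sound {W₀ : WeierstrassCurve ℤ} {E : TamLocal} (v : HeightOneSpectrum (𝓞 ℚ))
    (hv : natGenerator v = E.p) (hmin : (W₀.baseChange ℚ).IsMinimalAt v) (hc : E.check W₀ = true) :
    tam W₀ v ∈ E.vals := by
  dsimp only [tam]
  obtain ⟨hp, hn1, ⟨hΔn, hΔn'⟩, -⟩ := check_common hc
  haveI : Fact E.p.Prime := ⟨hp⟩
  haveI hE := isElliptic_of_check hc
  have hΔ1 : (E.p : ℤ) ∣ W₀.Δ := (dvd_pow_self _ (by omega)).trans hΔn
  have hord : (W₀.baseChange ℚ).ordMinimalDiscriminant v = E.n :=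
    ordMinimalDiscriminant_int_eq hv hmin hΔn hΔn'
  simp only [check, Bool.and_eq_true, Bool.or_eq_true, beq_iff_eq, decide_eq_true_eq, List.all_eq_true,
    Bool.not_eq_true', decide_eq_false_iff_not, List.mem_range] at hc
  obtain ⟨-, hk⟩ := hc
  rcases hk with (((⟨⟨h1, hc4⟩, hw⟩ | ⟨⟨h2, hc4⟩, hall⟩) | ⟨⟨⟨h3, hc4⟩, hp2⟩, heu⟩) | ⟨h4, hs⟩) | ⟨h5, hd⟩
  · -- split multiplicative
    have hs : (W₀.baseChange ℚ).HasSplitMultiplicativeReductionAt v :=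
      (hasSplitMultiplicativeReductionAt_int_iff hv hΔ1 hc4).mpr (splits_nodalPoly_of_dvd hc4 hw)
    rw [vals, if_pos h1, List.mem_singleton,
      localTamagawaNumber_eq_ordMinimalDiscriminant_of_hasSplitMultiplicativeReductionAt v _ hs, hord]
  · -- non-split, by exhaustion
    have hns : ¬ (W₀.baseChange ℚ).HasSplitMultiplicativeReductionAt v := fun hs ↦
      not_splits_nodalPoly_of_forall hc4 hall ((hasSplitMultiplicativeReductionAt_int_iff hv hΔ1 hc4).mp hs)
    rw [vals, if_neg (by omega), if_pos (Or.inl h2), List.mem_singleton]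
    have key := localTamagawaNumber_of_hasNonsplitMultiplicativeReductionAt_holds v (W₀.baseChange ℚ)
      (hasMultiplicativeReductionAt_int hv hΔ1 hc4) hns
    rw [hord] at key
    rw [key]
    by_cases he : Even E.n
    · rw [if_pos he, if_pos (Nat.even_iff.mp he)]
    · rw [if_neg he, if_neg (fun h ↦ he (Nat.even_iff.mpr h))]
  · -- non-split, by Euler's criterion
    have hns : ¬ (W₀.baseChange ℚ).HasSplitMultiplicativeReductionAt v := fun hs ↦
      not_splits_nodalPoly_of_euler hc4 hp2 (RootNumber.pow_eq_neg_one_of_binPowMod hp heu)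
        ((hasSplitMultiplicativeReductionAt_int_iff hv hΔ1 hc4).mp hs)
    rw [vals, if_neg (by omega), if_pos (Or.inr h3), List.mem_singleton]
    have key := localTamagawaNumber_of_hasNonsplitMultiplicativeReductionAt_holds v (W₀.baseChange ℚ)
      (hasMultiplicativeReductionAt_int hv hΔ1 hc4) hns
    rw [hord] at key
    rw [key]
    by_cases he : Even E.n
    · rw [if_pos he, if_pos (Nat.even_iff.mp he)]
    · rw [if_neg he, if_neg (fun h ↦ he (Nat.even_iff.mpr h))]
  · -- Step-2 Tate certificate: types II, III, IV
    rw [vals, if_neg (by omega), if_neg (by omega), if_pos h4]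
    have hK := (Step2Cert.sound (c := E.toStep2) v hv hs).1
    refine tam_mem_kodairaVals v hK ?_
    unfold Step2Cert.type; split_ifs <;> simp [kodairaVals]
  · -- deep Tate certificate: types I₀*, Iₙ*, IV*, III*, II*
    rw [vals, if_neg (by omega), if_neg (by omega), if_neg (by omega)]
    have hK := (DeepCert.sound (c := E.toDeep) v hv hmin hd).1
    refine tam_mem_kodairaVals v hK ?_
    unfold DeepCert.type; split_ifs <;> simp [kodairaVals]

/-- **Exact form**: when the certified set is a singleton `[c]`, `c_v = c`. [cite: SilvermanATAEC1994, IV.9.4] -/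
theorem sound_exact {W₀ : WeierstrassCurve ℤ} {E : TamLocal} (v : HeightOneSpectrum (𝓞 ℚ))
    (hv : natGenerator v = E.p) (hmin : (W₀.baseChange ℚ).IsMinimalAt v) (hc : E.check W₀ = true)
    {c : ℕ} (h1 : E.vals = [c]) : tam W₀ v = c := by
  simpa [h1] using sound v hv hmin hc

/-- The engines' value lies in the certified set (it is part of the check). [folklore] -/
theorem c_mem_vals (hc : E.check W = true) : E.c ∈ E.vals := (check_common hc).2.2.2

end TamLocal

/-! ### Self-tests (engine 1 = `tam.py`, engine 2 = PARI `elllocalred`; kernel = `decide`) -/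

namespace TamLocal

/-- `5077a1 = [0,0,1,-7,6]` (`N = 5077` prime, rank 3): `I₁` at `5077`, non-split by the Euler witness
(`d^{2538} ≡ −1`), `c₅₀₇₇ = 1` — the kernel check. [cite: CremonaAlgorithms1997, Tables] -/
theorem check_5077a1 : check ⟨5077, 71, 3, 0, 0, 0, 0, 1, 0, 0, 1⟩ ⟨0, 0, 1, -7, 6⟩ = true := by
  decide +kernel

/-- `5077a1`: `c_v = 1` at the place over `5077` (the equation is minimal there: `5077 ∤ c₄`). -/
theorem tam_5077a1 (v : HeightOneSpectrum (𝓞 ℚ)) (hv : natGenerator v = 5077) :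
    tam ⟨0, 0, 1, -7, 6⟩ v = 1 :=
  sound_exact (E := ⟨5077, 71, 3, 0, 0, 0, 0, 1, 0, 0, 1⟩) v hv
    (isMinimalAt_int_of_not_dvd_c₄ hv (by decide)) check_5077a1 rfl

end TamLocal

end Summit.BirchSwinnertonDyer.BirchSwinnertonDyer.Rank2Observatory.Tam
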